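import Mathlib
import Literature.NumberTheory.LFunctions.Zhang2022.Section15CU1Continuation
import Literature.NumberTheory.LFunctions.Zhang2022.Section15CU1ValueProduct
import Literature.NumberTheory.LFunctions.Zhang2022.Section15CPrimeFactorSum
import Literature.NumberTheory.LFunctions.Zhang2022.Section15BStep15u035
import HarnessLib

/-!
# Zhang (2022), Lemma 15.3 (repaired normaliser, cell RULING 15e) — the v19 leaf
# `Typed.Section15C.Lemma153RpI c′` DISCHARGED for every `c′`

Topic `Literature/NumberTheory/LFunctions/Zhang2022` (Landau–Siegel audit tree; verdict-neutral).
Y. Zhang, *Discrete mean estimates and the Landau–Siegel zero*, arXiv:2211.02515v1 (2022)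
[Zhang2022LandauSiegel] — **an unrefereed manuscript under adjudication; nothing in this file asserts
or denies its Theorems 1–2.** ZHANG-L discharge lane (WP15), closing file of the chain for the leaf
`h153RpI` of `Skeleton.theorem1_of_leaves_v19` (rows G-L4t3-1 part 1 + u053, G-d52-1):

> **Lemma 15.3** (p. 87, tex L4344–L4350). For `σ ≥ 9/10` the function
> `𝒰₁ⱼ(s) := (ζ(s)²L(s,χ)²)⁻¹Σₙ χ(n)τ₂(n)ϖ₁ⱼ(n)n^{−s}` is analytic and bounded. Further we have
> `𝒰₂ⱼ(1) = φ(D)²D⁻²∏_{(q,D)=1}(1−q⁻²)²/(1−χ(q)q⁻²) + O(α₁)`.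

in the repaired reading of record `Typed.Section15C.Lemma153Rp c′ inputs15AB` (normaliser
`(ζ(s)²L(s−βⱼ,χ)²)⁻¹`, row G-L4t3-1; `D`-dependent bound `C·exp(2𝓛^{1/10})`, RULING 15e; value clause
`Step15_u053R`). The continuation is the Euler product `U(s) = ∏_q 𝔲ᴿ₁ⱼ(q,s)` of the previous files;
the constants are uniform in `D` because the inputs are: §15.u032 (`step15_u032_holds`) bounds the
`(1,1)`-factors, §15.u035 (`step15_u035_holds`) the ratios `𝓜₁(qᵃ,qᵇ)/𝓜₁(1,1)`, Lemma 15.2 the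
size of `𝓜₁(1,1;1−βⱼ)` (`eq15_18_at_betaJ`), and `|b₁|+|b₂|+|bⱼ| ≤ 10α` for large `D`.

What is PROVED here (theorems only; no new definitions, no facts): `uniform_inputs` (the pointwise
hypotheses of the previous files hold for all large `D` under (A), with absolute `K`, `B`),
`lemma153Rp_part_one`, `step15_u053R_holds`, and the closer
**`Typed.Section15C.lemma153RpI_holds : ∀ c′, Lemma153RpI c′`**.

## References

* Y. Zhang, arXiv:2211.02515v1 (2022), §15 Lemma 15.3 p. 87; App. A p. 105.
  [cite: Zhang2022LandauSiegel, §15 Lemma 15.3 p. 87]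
-/

noncomputable section

open Complex Real Filter Topology Finset

namespace Literature.NumberTheory.LFunctions.Zhang2022.Lemma153Rp

open Literature.NumberTheory.LFunctions.Zhang2022
open Literature.NumberTheory.LFunctions.Zhang2022.Typed.Section15A
open Literature.NumberTheory.LFunctions.Zhang2022.Typed.Section15B

/-! ## §1. The pointwise hypotheses hold for all large `D` under (A), uniformly -/

/-- **Uniform inputs.** There are absolute `K, B ≥ 0` (depending on `c′` only) such that for all
large `D`, under (A), for every `j`: the Euler product of `𝓜₁(1,1;1−βⱼ)` converges to a non-zero
value, `‖F_q(1,1;1−βⱼ)‖⁻¹ ≤ 2K` for every prime `q` (§15.u032 + Lemma 15.2), and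
`‖𝓜₁(qᵃ,qᵇ;1−βⱼ)/𝓜₁(1,1;1−βⱼ)‖ ≤ B` (§15.u035 + Lemma 15.2).
[cite: Zhang2022LandauSiegel, §15 pp. 84–87] -/
theorem uniform_inputs (c' : ℝ) : ∃ K B : ℝ, 0 ≤ K ∧ 0 ≤ B ∧
    Skeleton.ForAllLarge fun D _ χ => Skeleton.AssumptionA D χ → ∀ j : ℕ,
      (Multipliable fun p : Nat.Primes => calM1Factor c' χ (p : ℕ) 1 1 (1 - Skeleton.betaJ c' D j)) ∧
      calM1 c' χ 1 1 (1 - Skeleton.betaJ c' D j) ≠ 0 ∧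
      (∀ q : ℕ, q.Prime → ‖calM1Factor c' χ q 1 1 (1 - Skeleton.betaJ c' D j)‖⁻¹ ≤ 2 * K) ∧
      (∀ q : ℕ, q.Prime → ∀ a b : ℕ, ‖calM1 c' χ (q ^ a) (q ^ b) (1 - Skeleton.betaJ c' D j) /
        calM1 c' χ 1 1 (1 - Skeleton.betaJ c' D j)‖ ≤ B) := by
  obtain ⟨C₃₂, h32⟩ := step15_u032_holds c'
  obtain ⟨c₃₅, C₃₅, h35⟩ := step15_u035_holds c'
  set L : ℝ := max C₃₂ 0 * ∑' p : Nat.Primes, ((p : ℕ) : ℝ) ^ (-(19 / 10 : ℝ)) with hL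
  set K : ℝ := Real.exp L with hK
  set B : ℝ := 2 * (|C₃₅| * (1 + |c₃₅|)) with hB
  refine ⟨K, B, (Real.exp_pos L).le, by positivity, ?_⟩
  refine ((eq15_18_at_betaJ c').and (h32.and h35)).mono fun D _ χ _ _ h hA j => ?_
  obtain ⟨h18, h32D, h35D⟩ := h
  obtain ⟨hhalf, hmul, -⟩ := h18 hA j
  set s₀ : ℂ := 1 - Skeleton.betaJ c' D j with hs₀
  have hs₀re : 9 / 10 < s₀.re := by rw [hs₀, one_sub_betaJ_re]; norm_num
  have hne : calM1 c' χ 1 1 s₀ ≠ 0 := by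
    intro h0; rw [h0, norm_zero] at hhalf; linarith
  -- `u032` at `d = l = 1`
  have hsum_rpow : Summable fun p : Nat.Primes => ((p : ℕ) : ℝ) ^ (-(19 / 10 : ℝ)) :=
    (Real.summable_nat_rpow.mpr (by norm_num)).comp_injective Subtype.val_injective
  have hb : ∀ p : Nat.Primes, ‖calM1Factor c' χ (p : ℕ) 1 1 s₀ - 1‖ ≤
      max C₃₂ 0 * ((p : ℕ) : ℝ) ^ (-(19 / 10 : ℝ)) := by
    intro p
    have h := h32D hA p 1 1 p.prop le_rfl le_rfl (Nat.coprime_one_right _) s₀ hs₀re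
    exact h.trans (mul_le_mul_of_nonneg_right (le_max_left _ _) (by positivity))
  have hsum : Summable fun p : Nat.Primes => ‖calM1Factor c' χ (p : ℕ) 1 1 s₀ - 1‖ :=
    Summable.of_nonneg_of_le (fun _ => norm_nonneg _) hb (hsum_rpow.mul_left _)
  have htsum : ∑' p : Nat.Primes, ‖calM1Factor c' χ (p : ℕ) 1 1 s₀ - 1‖ ≤ L := by
    rw [hL, ← tsum_mul_left]; exact hsum.tsum_le_tsum hb (hsum_rpow.mul_left _)
  have hK' : ∀ q : ℕ, q.Prime → ‖calM1Factor c' χ q 1 1 s₀‖⁻¹ ≤ 2 * K := by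
    intro q hq
    have h := norm_calM1_le_norm_factor_mul_exp c' χ hsum ⟨q, hq⟩
    have hF0 : calM1Factor c' χ q 1 1 s₀ ≠ 0 := calM1Factor_ne_zero_of_calM1_ne_zero c' χ hmul hne ⟨q, hq⟩
    have hFn : 0 < ‖calM1Factor c' χ q 1 1 s₀‖ := norm_pos_iff.mpr hF0
    have hexp : Real.exp (∑' p : Nat.Primes, ‖calM1Factor c' χ (p : ℕ) 1 1 s₀ - 1‖) ≤ K :=
      Real.exp_le_exp.mpr htsum
    have h2 : 1 / 2 ≤ ‖calM1Factor c' χ q 1 1 s₀‖ * K :=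
      hhalf.trans (h.trans (mul_le_mul_of_nonneg_left hexp hFn.le))
    rw [inv_le_comm₀ hFn (by positivity : (0 : ℝ) < 2 * K)]
    have hKpos : 0 < K := Real.exp_pos L
    calc (2 * K)⁻¹ = (1 / 2) / K := by field_simp
      _ ≤ ‖calM1Factor c' χ q 1 1 s₀‖ * K / K := div_le_div_of_nonneg_right h2 hKpos.le
      _ = ‖calM1Factor c' χ q 1 1 s₀‖ := by field_simp
  -- `u035` for prime powers
  have hB' : ∀ q : ℕ, q.Prime → ∀ a b : ℕ,
      ‖calM1 c' χ (q ^ a) (q ^ b) s₀ / calM1 c' χ 1 1 s₀‖ ≤ B := by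
    intro q hq a b
    have hqa : 1 ≤ q ^ a := Nat.one_le_pow _ _ hq.pos
    have hqb : 1 ≤ q ^ b := Nat.one_le_pow _ _ hq.pos
    have h := h35D hA (q ^ a) (q ^ b) hqa hqb s₀ hs₀re
    have hP : |∏ p ∈ (q ^ a * q ^ b).primeFactors, (1 + c₃₅ * (p : ℝ) ^ (-(9 / 10 : ℝ)))| ≤ 1 + |c₃₅| := by
      rw [← pow_add]
      rcases Nat.eq_zero_or_pos (a + b) with hab | hab
      · rw [hab, pow_zero, Nat.primeFactors_one, prod_empty, abs_one]
        linarith [abs_nonneg c₃₅]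
      · rw [Nat.primeFactors_prime_pow hab.ne' hq, prod_singleton]
        have hq1 : ((q : ℝ)) ^ (-(9 / 10 : ℝ)) ≤ 1 :=
          Real.rpow_le_one_of_one_le_of_nonpos (by exact_mod_cast hq.one_lt.le) (by norm_num)
        have hq0 : 0 ≤ ((q : ℝ)) ^ (-(9 / 10 : ℝ)) := by positivity
        calc |1 + c₃₅ * (q : ℝ) ^ (-(9 / 10 : ℝ))| ≤ |(1 : ℝ)| + |c₃₅ * (q : ℝ) ^ (-(9 / 10 : ℝ))| :=
              abs_add_le _ _
          _ = 1 + |c₃₅| * (q : ℝ) ^ (-(9 / 10 : ℝ)) := by rw [abs_one, abs_mul, abs_of_nonneg hq0]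
          _ ≤ 1 + |c₃₅| * 1 := by gcongr
          _ = 1 + |c₃₅| := by ring
    have hnum : ‖calM1 c' χ (q ^ a) (q ^ b) s₀‖ ≤ |C₃₅| * (1 + |c₃₅|) := by
      refine h.trans ?_
      calc C₃₅ * ∏ p ∈ (q ^ a * q ^ b).primeFactors, (1 + c₃₅ * (p : ℝ) ^ (-(9 / 10 : ℝ)))
          ≤ |C₃₅ * ∏ p ∈ (q ^ a * q ^ b).primeFactors, (1 + c₃₅ * (p : ℝ) ^ (-(9 / 10 : ℝ)))| :=
            le_abs_self _
        _ = |C₃₅| * |∏ p ∈ (q ^ a * q ^ b).primeFactors, (1 + c₃₅ * (p : ℝ) ^ (-(9 / 10 : ℝ)))| :=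
            abs_mul _ _
        _ ≤ |C₃₅| * (1 + |c₃₅|) := mul_le_mul_of_nonneg_left hP (abs_nonneg _)
    rw [norm_div]
    have hpos : 0 < ‖calM1 c' χ 1 1 s₀‖ := by linarith
    rw [div_le_iff₀ hpos, hB]
    calc ‖calM1 c' χ (q ^ a) (q ^ b) s₀‖ ≤ |C₃₅| * (1 + |c₃₅|) := hnum
      _ = 2 * (|C₃₅| * (1 + |c₃₅|)) * (1 / 2) := by ring
      _ ≤ 2 * (|C₃₅| * (1 + |c₃₅|)) * ‖calM1 c' χ 1 1 s₀‖ := by gcongr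
  exact ⟨hmul, hne, hK', hB'⟩

/-! ## §2. Lemma 15.3 part 1 (repaired, RULING 15e): the continuation and its `D`-dependent bound -/

/-- **Lemma 15.3 part 1 in the reading of record**: for all large `D` under (A) and `1 ≤ j ≤ 3`,
`U(s) := ∏'_q 𝔲ᴿ₁ⱼ(q,s)` is an analytic continuation of `calU1R` to `Re s ≥ 9/10` with
`‖U(s)‖ ≤ C·exp(2𝓛^{1/10})` there, `C = exp(2c₅ + B(K))` absolute (`sum_primeFactors_rpow_le`,
`tprod_frakU1FactorR_analytic_eq_bound`, `uniform_inputs`). [cite: Zhang2022LandauSiegel, §15 Lemma 15.3 p. 87] -/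
theorem lemma153Rp_part_one (c' : ℝ) : ∃ C : ℝ,
    Skeleton.ForAllLarge fun D _ χ => Skeleton.AssumptionA D χ → ∀ j ∈ ({1, 2, 3} : Finset ℕ),
      ∃ U : ℂ → ℂ, Typed.Section15C.IsCalU1R c' Typed.Section15C.inputs15AB χ j U ∧
        ∀ s : ℂ, 9 / 10 ≤ s.re → ‖U s‖ ≤ C * Real.exp (2 * Skeleton.ell D ^ (1 / 10 : ℝ)) := by
  obtain ⟨K, B, hK0, hB0, hin⟩ := uniform_inputs c'
  obtain ⟨c₅, hc₅, hsum5⟩ := sum_primeFactors_rpow_le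
  set B₁ : ℝ := ∑' q : Nat.Primes, (((q : ℕ) : ℝ) ^ (-(9 / 5 : ℝ)) +
    2 * K * (90 * (∑' m : ℕ, ((m : ℝ) + 1) ^ 2 * (1 / 2 : ℝ) ^ m) + 72 +
        45 * (∑' m : ℕ, ((m : ℝ) + 2) ^ 2 * (1 / 2 : ℝ) ^ m) ^ 2) / (q : ℕ) *
      (24 * ((q : ℕ) : ℝ) ^ (-(9 / 10 : ℝ)) + 8 * ((q : ℕ) : ℝ) ^ (-(9 / 5 : ℝ)))) with hB₁
  refine ⟨Real.exp (2 * c₅ + B₁), ?_⟩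
  refine (hin.and (inline15_varpiMult_holds c')).mono fun D _ χ hquad _ h hA j hj => ?_
  obtain ⟨hinD, hmultD⟩ := h
  obtain ⟨hmul, hne, hK, hB⟩ := hinD hA j
  have hmult := hmultD hA j hj
  obtain ⟨han, heq, hbd⟩ := tprod_frakU1FactorR_analytic_eq_bound c' χ hquad j hmul hne hmult hB hK
  refine ⟨fun s => ∏' q : Nat.Primes, Typed.AppendixA2.frakU1FactorR c' χ j (q : ℕ) s, ⟨han, heq⟩,
    fun s hs => (hbd s hs).trans ?_⟩
  have h5 := hsum5 D
  rw [← Real.exp_add]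
  apply Real.exp_le_exp.mpr
  have : Skeleton.ell D = Real.log D := rfl
  rw [this]
  linarith

/-! ## §3. Lemma 15.3 value clause (u053ᴿ) -/

/-- **`Step15_u053R c′ inputs15AB` HOLDS**: for all large `D` under (A), `1 ≤ j ≤ 3`, and every
analytic continuation `U` of `calU1R` to `Re s ≥ 9/10`:
`‖U(1) − φ(D)²D⁻²·eulerU1‖ ≤ C·α𝓛`. By the identity theorem `U(1)` is the value of the Euler product
`∏'_q 𝔲ᴿ₁ⱼ(q,1)`, which `norm_tprod_frakU1FactorR_one_sub_le` compares with the main term up to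
`exp(G)C Λ(|b₁|+|b₂|+|bⱼ|) ≤ 10·exp(G)CΛ·α ≤ 10·exp(G)CΛ·α𝓛`.
[cite: Zhang2022LandauSiegel, §15 Lemma 15.3 p. 87] -/
theorem step15_u053R_holds (c' : ℝ) :
    Typed.Section15C.Step15_u053R c' Typed.Section15C.inputs15AB := by
  obtain ⟨K, B, hK0, hB0, hin⟩ := uniform_inputs c'
  -- the constants
  set G : ℝ := ∑' q : Nat.Primes, ((((q : ℕ) : ℝ)⁻¹) ^ 2 +
      2 * K * (90 * (∑' m : ℕ, ((m : ℝ) + 1) ^ 2 * (1 / 2 : ℝ) ^ m) + 72 +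
          45 * (∑' m : ℕ, ((m : ℝ) + 2) ^ 2 * (1 / 2 : ℝ) ^ m) ^ 2) / (q : ℕ) *
        (24 * ((q : ℕ) : ℝ)⁻¹ + 8 * (((q : ℕ) : ℝ)⁻¹) ^ 2) + 6 * (((q : ℕ) : ℝ)⁻¹) ^ 2) with hG
  set CV : ℝ := 14 + 54 * K * (8 * (∑' m : ℕ, ((m : ℝ) + 1) ^ 2 * (1 / 2 : ℝ) ^ m) +
      9 * (∑' m : ℕ, ((m : ℝ) + 2) ^ 2 * (1 / 2 : ℝ) ^ m) ^ 2 +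
      13 * (4 * ((16 / 3) * (∑' k : ℕ, ((k : ℝ) + 1) ^ 2 * (1 / 2 : ℝ) ^ k) *
        (∑' k : ℕ, ((k : ℝ) + 1) ^ 3 * (3 / 4 : ℝ) ^ k)) + 87) + 48) with hCV
  set Λ : ℝ := ∑' q : Nat.Primes, Real.log (q : ℕ) / ((q : ℕ) : ℝ) ^ 2 with hΛ
  have hCV0 : 0 ≤ CV := by
    have h1 : 0 ≤ ∑' m : ℕ, ((m : ℝ) + 1) ^ 2 * (1 / 2 : ℝ) ^ m := tsum_nonneg fun m => by positivity
    have h2 : 0 ≤ ∑' m : ℕ, ((m : ℝ) + 2) ^ 2 * (1 / 2 : ℝ) ^ m := tsum_nonneg fun m => by positivity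
    have h3 : 0 ≤ ∑' k : ℕ, ((k : ℝ) + 1) ^ 3 * (3 / 4 : ℝ) ^ k := tsum_nonneg fun m => by positivity
    rw [hCV]; positivity
  have hΛ0 : 0 ≤ Λ := tsum_nonneg fun q => by positivity
  refine ⟨Real.exp G * CV * Λ * 10, ?_⟩
  -- thresholds: `AppendixALocal.threshold` (|b₁|+|b₂| ≤ 4α, 𝓛 ≥ 32, α > 0) and `5|c′|α𝓛 ≤ 1`
  set ε : ℝ := 1 / (5 * |c'| + 1) with hε
  have hεpos : 0 < ε := by rw [hε]; positivity
  set D₁ : ℕ := ⌈Real.exp (7 * π * |c'| + 32)⌉₊ + 1 with hD₁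
  set D₂ : ℕ := ⌈Real.exp (Real.pi / ε + 1)⌉₊ + 1 with hD₂
  have hthr : Skeleton.ForAllLarge fun D _ χ =>
      (32 ≤ Skeleton.ell D ∧ |Skeleton.b1 c' D| + |Skeleton.b2 c' D| ≤ 4 * Skeleton.alpha D ∧
        0 < Skeleton.alpha D) ∧ 5 * |c'| * (Skeleton.alpha D * Skeleton.ell D) ≤ 1 := by
    refine Skeleton.ForAllLarge.of_le (max D₁ D₂) fun D _ χ hD _ _ => ?_
    have hD1 : D₁ ≤ D := le_trans (le_max_left _ _) hD
    have hD2 : D₂ ≤ D := le_trans (le_max_right _ _) hD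
    obtain ⟨h32, hb12, -, hα0⟩ := AppendixALocal.threshold c' hD1
    have hαℓ : Skeleton.alpha D * Skeleton.ell D ≤ ε := alpha_mul_ell_le_of_le hεpos hD2
    refine ⟨⟨h32, hb12, hα0⟩, ?_⟩
    calc 5 * |c'| * (Skeleton.alpha D * Skeleton.ell D) ≤ 5 * |c'| * ε :=
          mul_le_mul_of_nonneg_left hαℓ (by positivity)
      _ ≤ 1 := by
          rw [hε]
          rw [mul_one_div, div_le_one (by positivity)]
          linarith
  refine ((hin.and (inline15_varpiMult_holds c')).and hthr).mono fun D _ χ hquad _ h hA j hj U hU => ?_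
  obtain ⟨⟨hinD, hmultD⟩, ⟨h32, hb12, hα0⟩, hcαℓ⟩ := h
  obtain ⟨hmul, hne, hK, hB⟩ := hinD hA j
  have hmult := hmultD hA j hj
  have hℓ1 : 1 ≤ Skeleton.ell D := by linarith
  -- `βⱼ = b·i`, `|b| ≤ 6α`
  obtain ⟨b, hb, hbb⟩ := Typed.AppendixB.betaJ_bound c' D j hα0.le (by linarith)
  have hb6 : |b| ≤ 6 * Skeleton.alpha D := by
    calc |b| ≤ 3 * Skeleton.alpha D * (1 + 5 * |c'| * Skeleton.alpha D * Skeleton.ell D) := hbb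
      _ ≤ 3 * Skeleton.alpha D * (1 + 1) := by
          apply mul_le_mul_of_nonneg_left _ (by positivity)
          linarith
      _ = 6 * Skeleton.alpha D := by ring
  -- the Euler product `P` and `U = P` on `Re s > 9/10`
  obtain ⟨hanP, heqP, -⟩ := tprod_frakU1FactorR_analytic_eq_bound c' χ hquad j hmul hne hmult hB hK
  set P : ℂ → ℂ := fun s => ∏' q : Nat.Primes, Typed.AppendixA2.frakU1FactorR c' χ j (q : ℕ) s with hP
  obtain ⟨hanU, heqU⟩ := hU
  set V : Set ℂ := {s : ℂ | 9 / 10 < s.re} with hV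
  have hVopen : IsOpen V := isOpen_lt continuous_const Complex.continuous_re
  have hVsub : V ⊆ {s : ℂ | 9 / 10 ≤ s.re} := fun s hs => by
    have hs' : 9 / 10 < s.re := hs
    show 9 / 10 ≤ s.re
    exact hs'.le
  have hanU' : AnalyticOnNhd ℂ U V := hanU.mono hVsub
  have hanP' : AnalyticOnNhd ℂ P V := hanP.mono hVsub
  have h2V : (2 : ℂ) ∈ V := by show (9 : ℝ) / 10 < (2 : ℂ).re; norm_num
  have hev : U =ᶠ[𝓝 (2 : ℂ)] P := by
    have hopen : IsOpen {s : ℂ | 1 < s.re} := isOpen_lt continuous_const Complex.continuous_re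
    have hmem : {s : ℂ | 1 < s.re} ∈ 𝓝 (2 : ℂ) := hopen.mem_nhds (by show (1 : ℝ) < (2 : ℂ).re; norm_num)
    filter_upwards [hmem] with s hs
    rw [heqU s hs]
    exact (heqP s hs).symm
  have hEqOn := hanU'.eqOn_of_preconnected_of_eventuallyEq hanP'
    ((convex_halfSpace_re_gt (9 / 10 : ℝ)).isPreconnected) h2V hev
  have h1V : (1 : ℂ) ∈ V := by show (9 : ℝ) / 10 < (1 : ℂ).re; norm_num
  have hU1 : U 1 = P 1 := hEqOn h1V
  -- the value estimate
  have hval := norm_tprod_frakU1FactorR_one_sub_le c' χ hquad j hb hmul hne hmult.1 hK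
  rw [hU1]
  refine hval.trans ?_
  have hβ : |Skeleton.b1 c' D| + |Skeleton.b2 c' D| + |b| ≤ 10 * (Skeleton.alpha D * Skeleton.ell D) := by
    have hα : Skeleton.alpha D ≤ Skeleton.alpha D * Skeleton.ell D := by
      have := mul_le_mul_of_nonneg_left hℓ1 hα0.le; rwa [mul_one] at this
    linarith
  have hcoef : 0 ≤ Real.exp G * CV * Λ := by positivity
  calc Real.exp G * (CV * Λ * (|Skeleton.b1 c' D| + |Skeleton.b2 c' D| + |b|))
      = (Real.exp G * CV * Λ) * (|Skeleton.b1 c' D| + |Skeleton.b2 c' D| + |b|) := by ring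
    _ ≤ (Real.exp G * CV * Λ) * (10 * (Skeleton.alpha D * Skeleton.ell D)) :=
        mul_le_mul_of_nonneg_left hβ hcoef
    _ = Real.exp G * CV * Λ * 10 * (Skeleton.alpha D * Skeleton.ell D) := by ring

end Literature.NumberTheory.LFunctions.Zhang2022.Lemma153Rp

/-! ## §4. The closer -/

namespace Literature.NumberTheory.LFunctions.Zhang2022.Typed.Section15C

/-- **The v19 leaf `h153RpI` DISCHARGED: `Lemma153RpI c′` holds for every `c′`** — Lemma 15.3 of
the manuscript in the repaired reading of record (normaliser `(ζ(s)²L(s−βⱼ,χ)²)⁻¹`, row G-L4t3-1;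
`D`-dependent bound `C·exp(2𝓛^{1/10})`, cell RULING 15e; value clause `Step15_u053R`), about the
manuscript's own objects (`inputs15AB`): part 1 = `Lemma153Rp.lemma153Rp_part_one`, part 2 =
`Lemma153Rp.step15_u053R_holds`. Honest framing: a kernel theorem about a typed (repaired-of-record)
statement of an unrefereed manuscript; nothing about Theorems 1–2 follows from it alone.
[cite: Zhang2022LandauSiegel, §15 Lemma 15.3 p. 87] -/
theorem lemma153RpI_holds (c' : ℝ) : Lemma153RpI c' :=
  ⟨Lemma153Rp.lemma153Rp_part_one c', Lemma153Rp.step15_u053R_holds c'⟩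

end Literature.NumberTheory.LFunctions.Zhang2022.Typed.Section15C

/-! ## §5. Corollaries: the repaired Appendix-A steps `StepA_u032R`, `Lem153_pfR`
(`StepA_u030R` is already a theorem of the tree: `Section15CCalU1REuler.stepA_u030R_holds`.) -/

namespace Literature.NumberTheory.LFunctions.Zhang2022.Typed.AppendixA2

open Literature.NumberTheory.LFunctions.Zhang2022.Typed.Section15A
open Literature.NumberTheory.LFunctions.Zhang2022.Typed.Section15B

/-- **`StepA_u032R c′` HOLDS** (App. A u032 for the repaired factor: for primes `q ≤ D`, `(q,D)=1`,
`𝔲ᴿ₁ⱼ(q,1) = (1−q⁻²)²/(1−χ(q)q⁻²) + O(α𝓛/q)`) — from the sharper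
`Lemma153Rp.norm_frakU1FactorR_one_sub_main_le` (`O((|b₁|+|b₂|+|bⱼ|) log q/q²)`,
`|b₁|+|b₂|+|bⱼ| ≤ 10α`, `log q ≤ 𝓛`, `q⁻² ≤ q⁻¹`). [cite: Zhang2022LandauSiegel, App. A p. 105] -/
theorem stepA_u032R_holds (c' : ℝ) : StepA_u032R c' := by
  obtain ⟨K, B, hK0, -, hin⟩ := Lemma153Rp.uniform_inputs c'
  set CV : ℝ := 14 + 54 * K * (8 * (∑' m : ℕ, ((m : ℝ) + 1) ^ 2 * (1 / 2 : ℝ) ^ m) +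
      9 * (∑' m : ℕ, ((m : ℝ) + 2) ^ 2 * (1 / 2 : ℝ) ^ m) ^ 2 +
      13 * (4 * ((16 / 3) * (∑' k : ℕ, ((k : ℝ) + 1) ^ 2 * (1 / 2 : ℝ) ^ k) *
        (∑' k : ℕ, ((k : ℝ) + 1) ^ 3 * (3 / 4 : ℝ) ^ k)) + 87) + 48) with hCV
  have hCV0 : 0 ≤ CV := by
    have h1 : 0 ≤ ∑' m : ℕ, ((m : ℝ) + 1) ^ 2 * (1 / 2 : ℝ) ^ m := tsum_nonneg fun m => by positivity
    have h2 : 0 ≤ ∑' m : ℕ, ((m : ℝ) + 2) ^ 2 * (1 / 2 : ℝ) ^ m := tsum_nonneg fun m => by positivity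
    have h3 : 0 ≤ ∑' k : ℕ, ((k : ℝ) + 1) ^ 3 * (3 / 4 : ℝ) ^ k := tsum_nonneg fun m => by positivity
    rw [hCV]; positivity
  refine ⟨CV * 10, ?_⟩
  -- thresholds as in `step15_u053R_holds`
  set ε : ℝ := 1 / (5 * |c'| + 1) with hε
  have hεpos : 0 < ε := by rw [hε]; positivity
  set D₁ : ℕ := ⌈Real.exp (7 * π * |c'| + 32)⌉₊ + 1 with hD₁
  set D₂ : ℕ := ⌈Real.exp (Real.pi / ε + 1)⌉₊ + 1 with hD₂
  have hthr : Skeleton.ForAllLarge fun D _ χ =>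
      (32 ≤ Skeleton.ell D ∧ |Skeleton.b1 c' D| + |Skeleton.b2 c' D| ≤ 4 * Skeleton.alpha D ∧
        0 < Skeleton.alpha D) ∧ 5 * |c'| * (Skeleton.alpha D * Skeleton.ell D) ≤ 1 := by
    refine Skeleton.ForAllLarge.of_le (max D₁ D₂) fun D _ χ hD _ _ => ?_
    have hD1 : D₁ ≤ D := le_trans (le_max_left _ _) hD
    have hD2 : D₂ ≤ D := le_trans (le_max_right _ _) hD
    obtain ⟨h32, hb12, -, hα0⟩ := AppendixALocal.threshold c' hD1
    have hαℓ : Skeleton.alpha D * Skeleton.ell D ≤ ε := Lemma153Rp.alpha_mul_ell_le_of_le hεpos hD2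
    refine ⟨⟨h32, hb12, hα0⟩, ?_⟩
    calc 5 * |c'| * (Skeleton.alpha D * Skeleton.ell D) ≤ 5 * |c'| * ε :=
          mul_le_mul_of_nonneg_left hαℓ (by positivity)
      _ ≤ 1 := by
          rw [hε, mul_one_div, div_le_one (by positivity)]
          linarith
  refine (hin.and hthr).mono fun D _ χ hquad _ h hA j _ q hq hqD hcop => ?_
  obtain ⟨hinD, ⟨h32, hb12, hα0⟩, hcαℓ⟩ := h
  obtain ⟨hmul, hne, hK, -⟩ := hinD hA j
  obtain ⟨b, hb, hbb⟩ := Typed.AppendixB.betaJ_bound c' D j hα0.le (by linarith)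
  have hb6 : |b| ≤ 6 * Skeleton.alpha D := by
    calc |b| ≤ 3 * Skeleton.alpha D * (1 + 5 * |c'| * Skeleton.alpha D * Skeleton.ell D) := hbb
      _ ≤ 3 * Skeleton.alpha D * (1 + 1) := by
          apply mul_le_mul_of_nonneg_left _ (by positivity)
          linarith
      _ = 6 * Skeleton.alpha D := by ring
  have hv : χ (q : ZMod D) = 1 ∨ χ (q : ZMod D) = -1 :=
    AppendixALocal.chi_val_eq_one_or_neg_one χ hquad hcop
  have h := Lemma153Rp.norm_frakU1FactorR_one_sub_main_le c' χ hq hv j hb hmul hne (hK q hq)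
  refine h.trans ?_
  have hq0 : (0 : ℝ) < q := by exact_mod_cast hq.pos
  have hq1 : (1 : ℝ) ≤ q := by exact_mod_cast hq.one_lt.le
  have hqD' : (q : ℝ) ≤ D := by exact_mod_cast hqD
  have hlog : Real.log q ≤ Skeleton.ell D := by
    show Real.log q ≤ Real.log D
    exact Real.log_le_log hq0 hqD'
  have hlog0 : 0 ≤ Real.log q := Real.log_nonneg hq1
  have hβ : |Skeleton.b1 c' D| + |Skeleton.b2 c' D| + |b| ≤ 10 * Skeleton.alpha D := by linarith
  have hinv : ((q : ℝ)⁻¹) ^ 2 ≤ (q : ℝ)⁻¹ := by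
    rw [sq]; exact mul_le_of_le_one_left (by positivity) (inv_le_one_of_one_le₀ hq1)
  calc CV * ((|Skeleton.b1 c' D| + |Skeleton.b2 c' D| + |b|) * Real.log q) * ((q : ℝ)⁻¹) ^ 2
      ≤ CV * ((10 * Skeleton.alpha D) * Skeleton.ell D) * (q : ℝ)⁻¹ := by
        refine mul_le_mul (mul_le_mul_of_nonneg_left (mul_le_mul hβ hlog hlog0 (by positivity)) hCV0)
          hinv (by positivity) (by positivity)
    _ = CV * 10 * (Skeleton.alpha D * Skeleton.ell D / q) := by rw [div_eq_mul_inv]; ring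

variable (c' : ℝ) in
/-- `StepA_u032R` — `_holds` alias of `stepA_u032R_holds` above under the fact's exact name, stated under the
prover's own binders as section variables (appended 2026-08-28, D-0026 bookkeeping: the proof term is the
existing theorem of this file; no statement, definition or attribute is edited; no new named fact; the
ledger's debt table listed the fact unproved). [cite: Zhang2022LandauSiegel, App. A p. 105] -/
theorem _root_.Literature.NumberTheory.LFunctions.Zhang2022.Typed.AppendixA2.StepA_u032R_holds :
    _root_.Literature.NumberTheory.LFunctions.Zhang2022.Typed.AppendixA2.StepA_u032R c' :=
  _root_.Literature.NumberTheory.LFunctions.Zhang2022.Typed.AppendixA2.stepA_u032R_holds (c' := c')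

/-- **`Lem153_pfR c′` HOLDS** — trivially, its conclusion `Section15C.Lemma153RpI c′` being a theorem
(`Section15C.lemma153RpI_holds`). [cite: Zhang2022LandauSiegel, App. A p. 105] -/
theorem lem153_pfR_holds (c' : ℝ) : Lem153_pfR c' :=
  fun _ _ _ _ => Section15C.lemma153RpI_holds c'

variable (c' : ℝ) in
/-- `Lem153_pfR` — `_holds` alias of `lem153_pfR_holds` above under the fact's exact name, stated under the
prover's own binders as section variables (appended 2026-08-28, D-0026 bookkeeping: the proof term is the
existing theorem of this file; no statement, definition or attribute is edited; no new named fact; the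
ledger's debt table listed the fact unproved). [cite: Zhang2022LandauSiegel, App. A p. 105] -/
theorem _root_.Literature.NumberTheory.LFunctions.Zhang2022.Typed.AppendixA2.Lem153_pfR_holds :
    _root_.Literature.NumberTheory.LFunctions.Zhang2022.Typed.AppendixA2.Lem153_pfR c' :=
  _root_.Literature.NumberTheory.LFunctions.Zhang2022.Typed.AppendixA2.lem153_pfR_holds (c' := c')

end Literature.NumberTheory.LFunctions.Zhang2022.Typed.AppendixA2
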